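import Mathlib
import HarnessLib
import HarnessLib.Audit
import Summits.SmoothPoincare4.Statement
import Literature.Topology.FourManifolds.CappellShaneson
import Literature.Topology.FourManifolds.HomotopyS4CompactProofs

/-!
Route: RootDecompAD

DORMANT since 2026-09-04T16:51:21Z (reconciler: no traction for 5.1 d (last activity item-proof-filed at 2026-08-30T14:47:10Z); parked, not closed — `ledger route dormant route-SmoothPoincare4-RootDecompAD --off` to reactivate) — unstaffed, not closed; items shared with open routes are served there. `ledger route dormant <id> --off` reactivates.

# Route RootDecompAD — SPC4 ⟸ Cappell–Shaneson spheres standard (pooled #0391; trace ladder decided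
in the kernel down to sixteen named matrices) ∧ non-CS homotopy 4-spheres standard (declared
residual) — the trace dial

X = CS ∧ NonCS (root decomposition cell decomp-sp4, lens 5 «finite/base range + asymptotic regime +
bridge», gen 9, node CSTraceLadder —
NEW OR-sibling root route; birth letter AD (package letter AC was advisory; AC = SizeInduction, born
2026-08-30T08:40:57Z, letters in CLEARED order); kernel file
decomp-sp4-lens-5/g9/CSTraceLadder.lean, rc 0, 0 sorry, 13 axiom guards). CS = `CSStandard` (POOLED
verbatim: body is
the tree constant `Literature.Topology.FourManifolds.CappellShanesonSpheresStandard` = item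
stmt-SmoothPoincare4-0391
`GluckLasagna.GlasCappellShanesonStandard`): every Cappell–Shaneson homotopy 4-sphere — surgery on
the section circle of the mapping torus
of A ∈ SL(3,ℤ), det(A−1) = ±1, either framing (tree `IsCappellShanesonSphere`) — is diffeomorphic to
S⁴. NonCS = `NonCSStandard` (NEW,
DECLARED RESIDUAL): every smooth homotopy 4-sphere (Statement binders) that is NOT a
Cappell–Shaneson sphere is diffeomorphic to S⁴. Inside
CS the lens is realised at MATRIX level with all three parts in print and in the kernel: FINITE
RANGE = Gompf's conjecture
(`GompfConjectureForTrace n`: every det(A−1)=1 matrix of trace n is Gompf equivalent to the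
Akbulut–Kirby matrix A₀) is a KERNEL THEOREM
for n ∈ [−64,69] ∪ {−73,−69,−67,−66,71,72,74,78} (Kim–Yamada 2023 Thm B, Iwaki 2025 Thm 5.1,
certified ideal-class computations in the
orders ℤ[Θₙ]; tree `iwaki2025_thm_5_1`); BRIDGE = Gompf's move X_{c,d,n} ∼ X_{c,d,n+kd} (tree
`gompfEquiv_standardCSMatrix_add_mul`,
proved) with Theorem A n ↔ 5−n (tree `gompfConjectureForTrace_iff_five_sub`, proved); ASYMPTOTIC
REGIME = the open tail of traces ≥ 70
other than 71,72,74,78, whose first rung [−73,78] is equivalent in the kernel to SIXTEEN named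
standard matrices being Gompf equivalent
to A₀ (tree `gompfConjectureForTrace_of_mem_Icc_neg_seventythree_seventyeight_iff'`).
Lean: `Summit.SmoothPoincare4.SmoothPoincare4.Theses.RootDecompAD.CSStandard ∧
Summit.SmoothPoincare4.SmoothPoincare4.Theses.RootDecompAD.NonCSStandard`

## Assembly
Pure logic over the two binders (route/glue.lean = kernel `CSTraceLadder.closes`, axioms
propext/Classical.choice/Quot.sound): given
M ≃ₕ S⁴, case on `IsCappellShanesonSphere M`; in the first case M is compact (tree theorem
`compactSpace_of_homotopyEquiv_sphere_four_holds`,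
Hatcher Prop. 3.29) and CS applies, in the second NonCS applies. Necessity: `nonCS_of_summit`
(kernel), `cs_of_summit` (kernel modulo the
Cappell–Shaneson homotopy-sphere fact schema `CSHomotopySphereFact`, which the tree DISCHARGES as
`nonempty_homotopyEquiv_sphere_four_of_isCappellShanesonSphere_holds` /
`CappellShanesonSpheresStandard.of_smoothPoincareFour` — module
`CappellShanesonHomotopySphereHolds`, stale:unbuilt on the farm snapshot at filing, hence quoted);
exactness `summit_iff`; residual
standing `nonCS_iff_summit_of_cs`. The matrix ladder is typed in the same file: `DecidedTraces`,
`GompfTail` ⟺ `GompfTailRight`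
(`gompfTail_iff_right`, by Theorem A), `Window78` ⟺ sixteen matrices (`window78_iff_sixteen`),
`TailFrom79`, and the attack line
`cs_of_gompfTail : GompfLeaves → DetOneNormalisation → GompfTail → CSStandard`,
`cs_of_window78_of_tailFrom79`, `summit_of_gompfTail_of_nonCS`.

Rationale: WHY THIS LINE. The Cappell–Shaneson spheres are «the most notable potential counterexamples» to SPC4
(KimYamada2023 §1, [corpus:paper:arxiv-1707.03860
p.2]) and the ONLY family of homotopy 4-spheres carrying an arithmetic structure theory: conjugacy
classes of trace-n Cappell–Shaneson
matrices are the ideal classes of the cubic order ℤ[Θₙ], fₙ(x) = x³ − nx² + (n−1)x − 1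
(Aitchison–Rubinstein 1984; Latimer–MacDuffee–Taussky,
tree `isConj_standardCSMatrix_iff_csIdeal`), Gompf's Δ-move (GompfAGT2010 Thm 2.1/§3) is the jump
(c,d,n) ↦ (c,d,n+kd) along a primitive
ideal ⟨Θₙ−c, d⟩, and the finite range has been DECIDED by certified computation (KimYamada2023 Thm B
on [−64,69]; Iwaki2025 = arXiv:2404.05096
Thm 5.1, [corpus:paper:arxiv-2404.05096 p.3]) — and re-certified IN THE TREE (14.6 kloc, files
CappellShanesonClassGroup*.lean) down to the
sixteen undecided special classes of Iwaki's table. The cell has no node on this axis (nodes A … AB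
grade Σ by handles, Kirby diagrams,
covers, metrics, stabilisations, fold maps, facet numbers — TREE.md v6); the retired route
CsArithmeticWalk carried the arithmetic but
concluded `CappellShanesonSpheresStandard` instead of S (closed not-a-thesis 2026-08-15) — this node
re-attaches the same wall to the summit
with a conforming `closes` and a declared complement. What is imported: algebraic number theory
(ideal class monoids of orders; the
algorithm of Marseglia, ANTS XVI [galaxy:pdf:8252011513617357060], beyond MAGMA's Dedekind-only
routines), certified computation (the
tree's chain certificates), Kirby calculus (Gompf's three topological leaves `gompf2010_deltaMove`,
`gompf2010_akbulutKirby_framings`,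
`akbulutKirby1979_sphere_four`, named facts). The lens answers «how far must the finite range reach
for the bridge to bite»: a class at
trace n bridges in ONE move into a window W iff it contains a primitive ideal of norm d with d ∣ n −
w for some w ∈ W (below n iff some
d ≤ 2n − 6, KY Lemma 6.1); since h(ℤ[Θₙ]) = n^{2+o(1)} (disc fₙ = (n²−5n+3)² − 32, regulator ≍
log²n, Brauer–Siegel) against ≤ n^{1+o(1)}
primitive ideals of norm ≤ 2n, no finite window lets the one-step bridge cover large traces: the
honest ceiling is «one-step descent dies»,
and the lift is a multi-step descent theorem or an invariant of Gompf moves (BC9).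

Workshop record (writer decomp-sp4-writer-1 g3, cell decomp-sp4, rung 0): NODE HOME/STATUS.md line
728 (lens-5 g9, 2026-08-30T08:33:21Z; package HOME/decomp-sp4-lens-5/g9/, SHA256SUMS verified by the
writer, all OK); kernel decomp-sp4-lens-5/g9/CSTraceLadder.lean (rc 0 · 0 sorry · 13 axiom guards
per the lens RESULT 729); route package route/{Route.md, route.json, glue.lean (by_cases
IsCappellShanesonSphere + compactness, 2/2 binders), <package-letter>.rendered.lean,
native_check.raw.txt (verdict OK), tribunal_quick.txt / tribunal_full.txt (tk=PROVISIONAL)} adopted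
under the birth letter AD (AA = FacetCensus 08:06:08Z, AB = FoldWallLadder 08:21:04Z, AC =
SizeInduction 08:40:57Z; letters in CLEARED order, writer NOTE 695(iii)); ONE pooled item:
CSStandard's statement is byte-identical (writer-verified) to the ledger signature of
stmt-SmoothPoincare4-0391 (GluckLasagna.GlasCappellShanesonStandard, support r4 there; that route is
CLOSED and #0391 was closed_as moot 2026-08-15 — the gate either revives it with this route attached
or mints a fresh item; the ROUTE-BORN line records which); no aliases, no definition at birth;
census data HOME/census/COSTUME-CENSUS-v6.md sha256
038be83a9e416ed550808f8c88f5534d693017df90180ec98673d22d7cef1f56 (v5 cb89ced1… superseded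
08:35:59Z). Critic verdict: critic decomp-sp4-crit-1 g3 CLEARED HOME/STATUS.md line 742
2026-08-30T08:43:49Z (ledger row 89; birth letter AD under the CLEARED-order policy, writer
decision); per-piece critic tags are appended to each item.

ERRATUM / PRIOR ART IN THE TREE (writer addendum 2026-08-30T09:26:40Z, from census
decomp-sp4-census-1 g6 ERRATUM decomp-sp4/STATUS.md line 770 after its T-CS16 job): SEVEN of Iwaki's
sixteen undecided classes — (178,191,73), (44,147,76), (65,147,76), (86,147,76), (128,147,76),
(46,173,76), (92,149,77) — were ALREADY certified Gompf-equivalent to A₀ in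
Summits/SmoothPoincare4/SmoothPoincare4/Theorems/CappellShanesonSpecialChains.lean +
CappellShanesonSpecialChainsSimilarities.lean (theorem sevenChains_gompfEquiv_akbulutKirbyMatrix;
cell pub-sp4gompf 2026-08-18, bundle papers/SmoothPoincare4/sp4-gompf-chains), and
Theorems/CappellShanesonTranspose.lean / CappellShanesonOpenPairsComplement.lean /
CappellShanesonTransposedTwist.lean organise the remaining open classes into transpose
(inverse-class) pairs ((37,155,70)∼(104,141,70)ᵀ, (23,171,73)∼(23,145,73)ᵀ,
(101,163,75)∼(31,197,75)ᵀ, (116,141,76)∼(98,153,76)ᵀ, (34,145,77)∼(61,253,77)ᵀ; (41,189,73)ᵀ ∼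
(83,105,73) settled; Kim–Yamada involution pairs (104,141,70)*∼G(116,141,76),
(23,145,73)*∼G(34,145,77); open question «X ∼ A₀ ⇒ Xᵀ ∼ A₀?») with exact order-level CLOSURE
certificates for the open classes in the bundle (no descent in d at any admissible trace up to norm
2.5·10⁵). CONSEQUENCE for this route: the attack line on CSStandard stated above («first tail rung
[−73,78] ⟺ SIXTEEN named matrices», kit ask T-CS16) is STALE by that prior art — the honest state is
«window [−73,78] ⟸ the NINE remaining classes (five transpose pairs modulo the transpose question)»,
all already in the tree/bundle; T-CS16 (census j339561) independently re-found the same seven chains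
and decides no new row; a composition file Theorems/CappellShanesonWindowFromNine.lean (window ⟸
nine classes, importing the tree's seven theorems) is the census seat's pending W-item. Items,
closes and the declared residual are UNCHANGED by this addendum; the BC4/BC5 novelty search of the
lens (routes + Literature only) and the writer's birth record missed Theses-external Theorems files
— recorded for the tribunal's T2 seat.

RANKED CRUXES. #2 CSStandard (crux) — CS (POOLED verbatim with stmt-SmoothPoincare4-0391): every
Cappell–Shaneson homotopy 4-sphere X (closed smooth 4-manifold with `IsCappellShanesonSphere X`,
i.e. obtained from the mapping torus of some A ∈ SL(3,ℤ), det(A−1) = ±1, by surgery on the section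
circle with either framing) is diffeomorphic to S⁴. Decided rows (mod Gompf's three topological
leaves): every sphere with a det-1 representative of trace in [−64,69] ∪
{−73,−69,−67,−66,71,72,74,78} (kernel `standard_of_trace_mem_decidedTraces`), the family A_m
(Akbulut 2010, Gompf 2010), Iwaki's 146 infinite families. Undecided NAMED rows: the 32 spheres of
the sixteen matrices X_{104,141,70}, X_{37,155,70}, X_{178,191,73}, X_{23,145,73}, X_{41,189,73},
X_{23,171,73}, X_{101,163,75}, X_{31,197,75}, X_{61,253,77}, X_{92,149,77}, X_{44,147,76},
X_{65,147,76}, X_{86,147,76}, X_{128,147,76}, X_{98,153,76}, X_{46,173,76}; undecided bulk: traces ≥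
79. [critic decomp-sp4-crit-1 g3 CLEARED HOME/STATUS.md line 742 2026-08-30T08:43:49Z (ledger row
89; birth letter AD under the CLEARED-order policy, writer decision): CS POOLED #0391 (body = the
Literature conjecture constant CappellShanesonSpheresStandard, byte-identical to
GluckLasagna.GlasCappellShanesonStandard; #0391 was closed_as moot 2026-08-15 with the CLOSED route
GluckLasagna — revived or re-minted by the gate at birth) · crux r2 · WEAKER (population: SPC4 on
the CS family; S ⟹ CS tree theorem) · P3-GENUINE NAMED ROWS (every sphere with a det-1
representative of trace in DecidedTraces standard mod three named leaves — kernel; first open row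
trace 70 hangs on X(104,141,70), X(37,155,70); 32 named undecided spheres) · INSTRUMENTED
(ideal-class / Gompf-move search, kit ask T-CS16; bridge + Theorem A PROVED in tree) · ceiling
stated honestly (one-step descent dies at ≈ n² classes vs ≲ n exits)] [difficulty: open-problem]
(why it might fail: an exotic Cappell–Shaneson sphere — the counting model (h(ℤ[Θₙ]) ≈ n² classes vs
≈ n exits) predicts Gompf-isolated classes from trace ≈ 70 on, and Iwaki's sixteen classes already
resist Lemma 5.2; any of their 32 spheres may be exotic.) [KimYamada2023, arXiv:1707.03860,
Iwaki2025, arXiv:2404.05096, GompfAGT2010, Akbulut2010, AitchisonRubinstein1984,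
CappellShaneson1976]
#3 NonCSStandard (crux) — NonCS (NEW, DECLARED RESIDUAL): for every smooth homotopy 4-sphere M
(Statement binders, e : M ≃ₕ S⁴), IF M is not a Cappell–Shaneson sphere of any matrix (¬
`IsCappellShanesonSphere M`), THEN M ≅ S⁴. Exotic-only scope (S⁴ = Σ(A₀) is itself a
Cappell–Shaneson sphere, Akbulut–Kirby 1979/1985 + Gompf 1991, so modulo that theorem and
`IsCappellShanesonSphereOf.of_diffeomorph` the hypothesis excludes every standard sphere); kernel
`nonCS_iff_summit_of_cs`: NonCS ⟺ S given CS. [critic decomp-sp4-crit-1 g3 CLEARED HOME/STATUS.md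
line 742 2026-08-30T08:43:49Z (ledger row 89; birth letter AD under the CLEARED-order policy, writer
decision): NonCS NEW crux r3 · DECLARED RESIDUAL · COSTUME-GIVEN-CS by the lens kernel theorem
(NonCS ⟺ S mod CS) · exotic-only scope · IDEA-NEEDED (no instrument; may contain every exotic
sphere) — honest] [difficulty: open-problem] (why it might fail: an exotic homotopy 4-sphere outside
the Cappell–Shaneson construction (e.g. a Gluck twist of a non-fibred 2-knot, or a cork twist of S⁴
if any is exotic) — NonCS is SPC4 on the complement of one countable named family.) [Kirby1997,
FreedmanGompfMorrisonWalker2010, GompfAGT2010, KimYamada2023]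

TWO-LAYER PLAN. CS is NOT split into items at birth: its natural cut «spheres with a representative
in A₀'s Gompf component» ∧ «the others» is costume
modulo theorems (the first half is a theorem mod leaves, so the second is CS again), and the
matrix-level ladder statements (GompfTail,
Window78, TailFrom79, DetOneNormalisation) are arithmetic, NOT implied by S, hence attack lines, not
pieces. Provers attack CS through
`cs_of_gompfTail` / `cs_of_window78_of_tailFrom79` and land, with `--supports <CS item>`, (i) the
sixteen Gompf equivalences
`GompfEquiv (standardCSMatrix c d n h) akbulutKirbyMatrix` one by one (certified chains, pattern
CappellShanesonGompfChains.lean; each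
closes a trace via the tree's `gompfConjectureForTrace_<n>_of_undecided`), (ii)
`DetOneNormalisation` (M-size, over the gluing predicates),
(iii) descent lemmas for traces ≥ 79 (Kim–Yamada Lemma 6.1 generalised to chains). NonCS is not
split (declared residual); its foreseen
cuts belong to other nodes (Gluck family L/P, torus length T, facet number AA) — an intersection
node «NonCS ∧ large facet number ∧ …» is
the cell's business, not this route's.

KILL CRITERIA. Both pieces are implied by S (NonCS in the kernel; CS by the tree theorem
`CappellShanesonSpheresStandard.of_smoothPoincareFour`), so a
refutation of either is an exotic S⁴: CS — one of the 32 named spheres (or any CS sphere) shown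
exotic; NonCS — an exotic sphere outside
the family. The ROUTE is retired as idle (not refuted) if the cut exposes nothing new: (i) CS
becomes a theorem (Gompf's conjecture for
all traces + leaves, or a direct trivialisation of all CS spheres) — then NonCS ≡ S outright: close
`superseded`, keep CS as a Literature
theorem; (ii) a proof that Gompf equivalence has MORE than one class together with no way to decide
the spheres of the isolated classes —
then CS's instrument is exhausted and the piece is «SPC4 on 32+ named spheres» with no lever (park
dormant, hand the named spheres to the
recognition routes as specimens). BC2 probes CS → S, NonCS → S, CS → NonCS, NonCS → CS all FAIL
(bc/bc2probe.json 11/11 incl. the cheap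
converse S → CS); BC7 CLEAN ×3 (CS written out, CS pooled constant, NonCS [informational
crux.summit-implies]).

NOT DECOMPOSED YET. CS by Gompf component (costume mod theorems, see Two-layer plan); CS by framing
(ε = 0 vs 1: Aitchison–Rubinstein settle ε = 0 only for
A_m — no general theorem, so no decided half); NonCS at all. The negative side (¬CS from a
Gompf-move invariant; CsArithmeticWalk's
CsawNotGompfStandard) is not filed as an item: an isolated Gompf class does NOT give an exotic
sphere, only a specimen.

CHEAPEST FALSIFIER. T-CS16 (census seat / kit, external and reproducible; one batch job): for each
of the sixteen undecided triples (c,d,n) run Iwaki's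
procedure one level deeper — breadth-first over Gompf moves n' = n + kd and re-standardisations
(c',d') of the transported ideal class in
ℤ[Θ_{n'}] (class-equality tests by PARI/GP `bnfisprincipal`, conductor bookkeeping for non-maximal
ℤ[Θ_{n'}] as in the tree's trace-27/76
files, or Marseglia's ideal-class-monoid algorithm), excursion |n'| ≤ 10⁴, chain length ≤ 6 —
emitting each chain as a certificate in the
format of CappellShanesonGompfChains.lean; the tree then PROVES
`gompfConjectureForTrace_70/73/75/76/77` via its `_of_undecided` theorems
(sixteen kernel rows of CS close; decided window becomes [−73,78]). A documented failure at that
depth is the first quantitative evidence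
for a Gompf-isolated class and promotes the 32 spheres to prime specimens for every recognition
route. Desk check that kills the LINE: none
cheap — «Gompf equivalence is trivial» and «some CS sphere is exotic» are both open; the node dies
only with S.

NUMBERS. Decided traces (kernel): 134 + 8 = 142 values; certified ideal classes behind them: 657
non-trivial classes for 3 ≤ n ≤ 69 (KY tables),
h(70) = 44, h(76) = 35 (Iwaki §4.3), eleven exceptional chains (KY) + Iwaki's special chains;
undecided: 16 classes at traces 70 (2),
73 (4), 75 (2), 76 (6), 77 (2) [two further special classes (34,145,77), (116,141,76) move to −68,
−65 and are covered by the others];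
first fully open trace: 79. Counting model (CsArithmeticWalk § Numbers): h(ℤ[Θₙ]) ≈ n²/(10.6 log n
log(n/2)); one-step exits ≤ n^{1+o(1)};
predicted crossover where most classes have no one-step descent: n ≈ 10³. Gompf 2010 Cor 3.5: |d| <
17 or trace window [−6,9] decided by
hand; KY: window length 134; Iwaki: 146 infinite families X_{c,p,p²k+n₀}. Kernel certificate:
CSTraceLadder.lean rc 0, 0 sorry, 13 axiom
guards = [propext, Classical.choice, Quot.sound] (including `window78_iff_sixteen` and
`trace70_standard_of_two_classes`, i.e. the tree's
certified computations carry no `ofReduceBool`).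

DEFINITION REQUESTS. None. Everything is typed over tree declarations (`IsCappellShanesonSphere`,
`IsCappellShanesonSphereOf`, `GompfEquiv`,
`GompfConjectureForTrace`, `standardCSMatrix`, `csPoly`, `akbulutKirbyMatrix`). Wanted as a SUPPORT
lemma (not a definition):
`DetOneNormalisation` — every Cappell–Shaneson sphere is one of a matrix with det(A−1) = 1 (replace
A by A⁻¹; Gompf 2010 §2), M-size over
`IsOpenGluingWith`/`mappingTorusRel`.

Novelty: Searches RUN (2026-08-30): `rg CappellShaneson Summits/SmoothPoincare4/SmoothPoincare4/Theses/` → 10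
files: CsArithmeticWalk (CLOSED
not-a-thesis: assembly concluded CS, not S), GluckLasagna (#0391 as one of several hypotheses of a
lasagna-module thesis), RootDecompI /
RootDecompAA / Stabilisation / SullivanDual / CircularKirby / PIC / QuotientSpheres /
SmallBranchSpheres / SymplecticCap (CS cited as rows or
barrier placement only); cell TREE.md v6 + STATUS NODE lines of lenses 1–4, 6 (g0–g9): no node with
a Cappell–Shaneson piece or an
arithmetic grading. `ledger negatives --problem SmoothPoincare4` → 0 statements. Corpus: `lit search
"Cappell-Shaneson Gompf conjecture
trace" --source local` → [corpus:paper:arxiv-1707.03860 p.2, p.12, p.20] (Thm B, Remark 1.1, Lemma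
6.1), [corpus:paper:arxiv-2404.05096
p.3] (Iwaki Thm 5.1), [corpus:paper:arxiv-2203.13332 p.14] (Kim's survey quoting the window),
[corpus:paper:arxiv-2203.14270 p.1] (FGMW's
strategy on the CS family); `lit search --hybrid "Cappell-Shaneson homotopy spheres Gompf
equivalence trace ideal classes"` → books only
([corpus:book:gordon1984-four-manifold-theory p.35], [corpus:book:freedman1990-topology-4-manifolds
p.224]); galaxy `"Cappell-Shaneson|Gompf
equivalence|Akbulut-Kirby sphere" --star all` → 8 panama book rows (Hillman, Donaldson–Thomas LMS
volumes; no new result), `"ideal class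
monoid|Latimer-MacDuffee" --star pdf` → [galaxy:pdf:8252011513617357060] Marseglia, ANTS XVI
(conjugacy classes of integral matrices  [refs: paper:arxiv-1707.03860, paper:arxiv-2404.05096, paper:arxiv-2203.13332, paper:arxiv-2203.14270, book:gordon1984-four-manifold-theory, book:freedman1990-topology-4-manifolds, KimYamada2023, Iwaki2025]

Barriers (technique_class: Cappell-Shaneson, Gompf moves, ideal classes, Kirby calculus): - technique_class: Cappell-Shaneson, Gompf moves, ideal classes, Kirby calculus
- Literature.Barriers.SmoothPoincare4.CappellShanesonFamilyBarrier: inside, as the DECIDED BASE —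
the barrier says no technique may «detect» exoticness on the family A_m (all standard,
Akbulut/Gompf); this route asserts standardness, uses A_m ⊂ A₀'s Gompf component as decided rows,
and looks for exotic candidates only among classes NOT Gompf-equivalent to A₀
(CappellShanesonFamilyStandard.lean `exoticCappellShanesonSphere_univ_iff`: an exotic CS sphere ⟺
¬CS).
- Literature.Barriers.SmoothPoincare4.TopologicalBarrierFour: consistent — no homeomorphism
invariant is used; rows are decided by EXHIBITED diffeomorphisms (Kirby calculus along certified
Gompf chains).
- Literature.Barriers.SmoothPoincare4.StableBarrierFour: consistent — no stable/gauge invariant is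
asked to detect a CS sphere (they all vanish on homotopy spheres); the negative side would need an
invariant of Gompf MOVES on matrices (arithmetic), explicitly outside this class.
- Literature.Barriers.SmoothPoincare4.GaugeSumBarrierFour: consistent — Seiberg–Witten/Donaldson
data play no role.
- Literature.Barriers.SmoothPoincare4.HCobordismBarrierFour: not invoked — no piece infers
diffeomorphism from h-cobordism.
- Literature.Barriers.SmoothPoincare4.HCobordismInvariantBarrierFour: consistent — no h-cobordism
invariant is used.
- Literature.Barriers.SmoothPoincare4.StrictPropertyTwoRBarrier: not invoked — the CS 2-handlebodies
without 3-han

History (route lifecycle, newest last):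
- 2026-08-30T08:54:15Z · rev 1: restated CSStandard (stmt-SmoothPoincare4-31396) — conjecture migration: CappellShanesonSpheresStandard is now Summit.SmoothPoincare4.SmoothPoincare4.CappellShanesonSpheresStandard (gate:conjectures)
- 2026-08-31T02:28:03Z · RESIDUAL declared: TailOrbitStandard (stmt-SmoothPoincare4-32670) — summit-strength until shown otherwise: g18 schema migration (D-0170): tribunal residual of record (stmt-SmoothPoincare4-32670, route tribunal.residual; TREE-IN (planner-decomp-sp4-writer-1-g18-0)
- 2026-08-31T02:28:03Z · RESIDUAL declared: NonCSStandard (stmt-SmoothPoincare4-31397) — summit-strength until shown otherwise: g18 schema migration (D-0170): tribunal residual of record (stmt-SmoothPoincare4-31397, route tribunal.residual; TREE-IN (planner-decomp-sp4-writer-1-g18-0)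
- 2026-09-04T16:51:21Z · DORMANT — reconciler: no traction for 5.1 d (last activity item-proof-filed at 2026-08-30T14:47:10Z); parked, not closed — `ledger route dormant route-SmoothPoincare4-Roo (operator:999:1034430)

sub-problem: SmoothPoincare4 · status: dormant · opened planner-decomp-sp4-writer-1-g3-0 2026-08-30T08:49:41Z · rev 2 · ledger route-SmoothPoincare4-RootDecompAD
GENERATED by the gate from the ledger (D-0016/17). Provers cite these decls: `theorem foo : Summit.SmoothPoincare4.SmoothPoincare4.Theses.RootDecompAD.<Decl> := …` in Summits/SmoothPoincare4/SmoothPoincare4/Theorems/<Name>.lean.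
-/

namespace Summit.SmoothPoincare4.SmoothPoincare4.Theses.RootDecompAD

open scoped BigOperators Topology Manifold Classical MeasureTheory ProbabilityTheory Matrix InnerProductSpace ComplexConjugate ContinuousMap
open Filter Set Function TopologicalSpace MeasureTheory

attribute [summit_statement] _root_.SmoothPoincare4

open Literature.SPC4

/-- item stmt-SmoothPoincare4-31396 · crux · rank 2 · SPLIT (gen 1) into TransposeClosure, WindowOrbitStandard, DualClosure, TailOrbitStandard + glue CSStandardGlue · direct attempts still welcome (low priority) · by planner
why it might fail: an exotic Cappell–Shaneson sphere — the counting model (h(ℤ[Θₙ]) ≈ n² classes vs ≈ n exits) predicts Gompf-isolated classes from trace ≈ 70 on, and Iwaki's sixteen classes already resist Lemma 5.2; any of their 32 spheres may be exotic.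
sources: KimYamada2023, arXiv:1707.03860, Iwaki2025, arXiv:2404.05096, GompfAGT2010, Akbulut2010
[crux] CS (POOLED verbatim with stmt-SmoothPoincare4-0391): every Cappell–Shaneson homotopy 4-sphere
X (closed smooth 4-manifold with `IsCappellShanesonSphere X`, i.e. obtained from the mapping torus
of some A ∈ SL(3,ℤ), det(A−1) = ±1, by surgery on the section circle with either framing) is
diffeomorphic to S⁴. Decided rows (mod Gompf's three topological leaves): every sphere with a det-1
representative of trace in [−64,69] ∪ {−73,−69,−67,−66,71,72,74,78} (kernel
`standard_of_trace_mem_decidedTraces`), the family A_m (Akbulut 2010, Gompf 2010), Iwaki's 146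
infinite families. Undecided NAMED rows: the 32 spheres of the sixteen matrices X_{104,141,70},
X_{37,155,70}, X_{178,191,73}, X_{23,145,73}, X_{41,189,73}, X_{23,171,73}, X_{101,163,75},
X_{31,197,75}, X_{61,253,77}, X_{92,149,77}, X_{44,147,76}, X_{65,147,76}, X_{86,147,76},
X_{128,147,76}, X_{98,153,76}, X_{46,173,76}; undecided bulk: traces ≥ 79. [critic decomp-sp4-crit-1
g3 CLEARED HOME/STATUS.md line 742 2026-08-30T08:43:49Z (ledger row 89; birth letter AD under the
CLEARED-order policy, writer decision): CS POOLED #0391 (body = the Literature conjecture constant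
CappellShanesonSpheresStandard, byte-identical to GluckLasag -/
@[route_item "route-SmoothPoincare4-RootDecompAD"]
def CSStandard : Prop :=
  Literature.Topology.FourManifolds.CappellShanesonSpheresStandard

-- parent: CSStandard · child (gen 1)
/--     item stmt-SmoothPoincare4-32667 · crux · rank 201 · open
    parent: CSStandard · by planner
    why it might fail: Σ(A) ≅ S⁴ but Σ(Aᵀ) exotic for a Gompf-isolated class whose transpose partner is also isolated (census: pairs (104,141,70)/(37,155,70) resist descent to norm 2.5e5); no sphere-level A ↔ Aᵀ move is in print (Gompf 2010 §3 uses ᵀ only as an algebraic normal form).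
    sources: KimYamada2023, arXiv:1707.03860, Iwaki2025, arXiv:2404.05096, GompfAGT2010, arXiv:0908.1914
[crux] TransposeClosure (NEW, BRIDGE/symmetry, child 1 of the glued split of CSStandard
stmt-SmoothPoincare4-31396; species R): for every A ∈ SL(3,ℤ), IF every compact smooth
Cappell–Shaneson sphere of A (either framing; tree predicate `IsCappellShanesonSphereOf A X`) is
diffeomorphic to S⁴, THEN so is every Cappell–Shaneson sphere of the TRANSPOSE Aᵀ (vacuous unless
det(A−1) = ±1). Aᵀ presents the inverse ideal class of ℤ[Θₙ] (Latimer–MacDuffee–Taussky) = the dual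
T³-bundle over S¹; X_{c,d,n}ᵀ ∼ X_{c,|a|,n} (tree, explicit intertwiner). S-implied (S ⇒ CSStandard
⇒ TC, kernel); strictly weaker than CSStandard (says nothing about a class none of whose
⟨ᵀ,*⟩-partners is recognised). Load-bearing in the glue: it transports recognition across the five
transpose pairs among the window's open classes and DECIDES X_{41,189,73} and its dual outright
(X_{41,189,73}ᵀ ∼ X_{83,105,73} ∼G X_{83,105,−32} ∼ A₀, kernel `std_M73c` mod Gompf's leaves): 18
open Gompf classes → 6 decisions. Arithmetic shadow «X ∼G A₀ ⇒ Xᵀ ∼G A₀» = the tree's recorded OPEN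
QUESTION (Theorems/CappellShanesonTranspose.lean); kernel
HOME/decomp-sp4-lens-5/g11/SymmetryWindow.lean §1–§5. [lens-5 g11 «SymmetryWindow» NODE de -/
@[route_item "route-SmoothPoincare4-RootDecompAD"]
def TransposeClosure : Prop :=
  open scoped ContDiff Manifold in ∀ A : Matrix.SpecialLinearGroup (Fin 3) ℤ, (∀ (X : Type) [TopologicalSpace X] [T2Space X] [SecondCountableTopology X] [ChartedSpace (EuclideanSpace ℝ (Fin 4)) X] [IsManifold (𝓡 4) ∞ X] [CompactSpace X], Literature.Topology.FourManifolds.IsCappellShanesonSphereOf A X → Nonempty (X ≃ₘ⟮𝓡 4, 𝓡 4⟯ (Metric.sphere (0 : EuclideanSpace ℝ (Fin 5)) 1))) → (∀ (X : Type) [TopologicalSpace X] [T2Space X] [SecondCountableTopology X] [ChartedSpace (EuclideanSpace ℝ (Fin 4)) X] [IsManifold (𝓡 4) ∞ X] [CompactSpace X], Literature.Topology.FourManifolds.IsCappellShanesonSphereOf (Matrix.SpecialLinearGroup.transpose A) X → Nonempty (X ≃ₘ⟮𝓡 4, 𝓡 4⟯ (Metric.sphere (0 : EuclideanSpace ℝ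 (Fin 5)) 1)))

-- parent: CSStandard · child (gen 1)
/--     item stmt-SmoothPoincare4-32668 · crux · rank 202 · open
    parent: CSStandard · by planner
    why it might fail: one of the three orbit classes X_{104,141,70}, X_{23,145,73}, X_{101,163,75} could consist of exotic spheres only — census closure certificates find NO Gompf descent for them or their partners up to norm 2.5e5 (cs16 j339561), so Kirby calculus beyond Gompf's moves is needed.
    sources: KimYamada2023, arXiv:1707.03860, Iwaki2025, arXiv:2404.05096, GompfAGT2010, arXiv:0908.1914
[crux] WindowOrbitStandard (FINITE RANGE, INSTRUMENTED, child 3 of the glued split of CSStandard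
stmt-SmoothPoincare4-31396; species R): for every A ∈ SL(3,ℤ) in the Iwaki window up to inversion —
det(A−1) = 1 ∧ tr A ∈ [−73,78], or det(A−1) = −1 ∧ tr A ∈ [−74,77] (then A⁻¹ has det 1 and trace tr
A + 1) — S⁴-recognition holds for A, OR for Aᵀ, OR (det(A−1) = 1) for the Kim–Yamada dual A* («S⁴
occurs in the ⟨ᵀ,*⟩-orbit of every window class»). S-implied; strictly weaker than CSStandard and
than plain window recognition (the disjunction is what makes TransposeClosure/DualClosure
load-bearing in the glue). DECIDED ROWS (mod Gompf's three leaves, tree theorems KimYamada Thm B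
`forall_gompfConjectureForTrace_Icc_neg_sixtyfour_sixtynine`, Iwaki Thm 5.1 `iwaki2025_thm_5_1`, the
tree's seven special chains): every det-1 class of the window except EIGHTEEN Gompf classes (36
named spheres): X_{104,141,70}, X_{37,155,70}, X_{23,145,73}, X_{23,171,73}, X_{41,189,73},
X_{101,163,75}, X_{31,197,75}, X_{98,153,76}, X_{116,141,76}, X_{61,253,77}, X_{34,145,77} and the
duals 70b*,73b*,73c*,75a*,75b*,76a*,77a* at traces −65…−72. INSTRUMENT (kernel §4): mod
TransposeClosure ∧ DualClosure these are THR -/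
@[route_item "route-SmoothPoincare4-RootDecompAD"]
def WindowOrbitStandard : Prop :=
  open scoped ContDiff Manifold in ∀ A : Matrix.SpecialLinearGroup (Fin 3) ℤ, ((((A : Matrix (Fin 3) (Fin 3) ℤ) - 1).det = 1 ∧ Matrix.trace (A : Matrix (Fin 3) (Fin 3) ℤ) ∈ Set.Icc (-73 : ℤ) 78) ∨ (((A : Matrix (Fin 3) (Fin 3) ℤ) - 1).det = -1 ∧ Matrix.trace (A : Matrix (Fin 3) (Fin 3) ℤ) ∈ Set.Icc (-74 : ℤ) 77)) → (∀ (X : Type) [TopologicalSpace X] [T2Space X] [SecondCountableTopology X] [ChartedSpace (EuclideanSpace ℝ (Fin 4)) X] [IsManifold (𝓡 4) ∞ X] [CompactSpace X], Literature.Topology.FourManifolds.IsCappellShanesonSphereOf A X → Nonempty (X ≃ₘ⟮𝓡 4, 𝓡 4⟯ (Metric.sphere (0 : EuclideanSpace ℝ (Fin 5)) 1))) ∨ (∀ (X : Type) [TopologicalSpace X] [T2Space X] [SecondCountableTopology X] [ChartedSpace (EuclideanSpace ℝ (Fin 4)) X] [IsManifold (𝓡 4) ∞ X] [CompactSpace X],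 Literature.Topology.FourManifolds.IsCappellShanesonSphereOf (Matrix.SpecialLinearGroup.transpose A) X → Nonempty (X ≃ₘ⟮𝓡 4, 𝓡 4⟯ (Metric.sphere (0 : EuclideanSpace ℝ (Fin 5)) 1))) ∨ (((A : Matrix (Fin 3) (Fin 3) ℤ) - 1).det = 1 ∧ ∃ B : Matrix.SpecialLinearGroup (Fin 3) ℤ, (B : Matrix (Fin 3) (Fin 3) ℤ) = (A : Matrix (Fin 3) (Fin 3) ℤ) * (A : Matrix (Fin 3) (Fin 3) ℤ) + (1 - Matrix.trace (A : Matrix (Fin 3) (Fin 3) ℤ)) • (A : Matrix (Fin 3) (Fin 3) ℤ) + 1 ∧ ∀ (X : Type) [TopologicalSpace X] [T2Space X] [SecondCountableTopology X] [ChartedSpace (EuclideanSpace ℝ (Fin 4)) X] [IsManifold (𝓡 4) ∞ X] [CompactSpace X], Literature.Topology.FourManifolds.IsCappellShanesonSphereOf B X → Nonempty (X ≃ₘ⟮𝓡 4, 𝓡 4⟯ (Metric.sphere (0 : EuclideanSpace ℝ (Fin 5)) 1)))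

-- parent: CSStandard · child (gen 1)
/--     item stmt-SmoothPoincare4-32669 · crux · rank 203 · open
    parent: CSStandard · by planner
    why it might fail: A* lives at trace 5 − n with a different T³-bundle; KY Lemma 3.5 transports Gompf chains, not diffeomorphisms — for a Gompf-isolated A with Σ(A) ≅ S⁴ by an ad-hoc Kirby move nothing forces Σ(A*) ≅ S⁴ (first candidates: X_{101,163,75} vs its dual X_{120,163,−70}).
    sources: KimYamada2023, arXiv:1707.03860, Iwaki2025, arXiv:2404.05096, GompfAGT2010, arXiv:0908.1914
[crux] DualClosure (NEW at sphere level, BRIDGE n ↔ 5−n, child 2 of the glued split of CSStandard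
stmt-SmoothPoincare4-31396; species R): for A, B ∈ SL(3,ℤ) with det(A−1) = 1 and B = A² + (1 − tr
A)·A + 1 (the Kim–Yamada dual A*, an involution with tr A* = 5 − tr A; KimYamada2023 Def 3.0/Thm
3.1/Lemma 3.6 = tree `csDual`, `csDual_csDual`), IF every Cappell–Shaneson sphere of A is
diffeomorphic to S⁴ THEN so is every Cappell–Shaneson sphere of B. S-implied; strictly weaker than
CSStandard. Its ARITHMETIC shadow A ∼G A′ ⇒ A* ∼G A′* IS a theorem (KY Lemma 3.5 = tree
`gompfEquiv_csDual`; with A₀* ∼ A₀), so DualClosure HOLDS on A₀'s Gompf component (kernel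
`std_csDual_of_gompfEquiv_akbulutKirbyMatrix`, mod leaves) and is open exactly on Gompf-ISOLATED
classes — the census-predicted population (T-CS79: one-step descent fraction 0.87 → 0.29 for traces
70 → 400). Load-bearing: merges trace 70 with 76 and 73 with 77 among the open window classes (70a*
∼G X_{116,141,76}, 73a* ∼G X_{34,145,77}, kernel `std_duals`): with TransposeClosure, 18 classes → 3
decisions (kernel `std_window_named_iff_three`). [lens-5 g11 «SymmetryWindow» NODE decomp-sp4/STATUS
875; critic decomp-sp4-crit-1 g4 CLEARED -/
@[route_item "route-SmoothPoincare4-RootDecompAD"]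
def DualClosure : Prop :=
  open scoped ContDiff Manifold in ∀ A B : Matrix.SpecialLinearGroup (Fin 3) ℤ, ((A : Matrix (Fin 3) (Fin 3) ℤ) - 1).det = 1 → (B : Matrix (Fin 3) (Fin 3) ℤ) = (A : Matrix (Fin 3) (Fin 3) ℤ) * (A : Matrix (Fin 3) (Fin 3) ℤ) + (1 - Matrix.trace (A : Matrix (Fin 3) (Fin 3) ℤ)) • (A : Matrix (Fin 3) (Fin 3) ℤ) + 1 → (∀ (X : Type) [TopologicalSpace X] [T2Space X] [SecondCountableTopology X] [ChartedSpace (EuclideanSpace ℝ (Fin 4)) X] [IsManifold (𝓡 4) ∞ X] [CompactSpace X], Literature.Topology.FourManifolds.IsCappellShanesonSphereOf A X → Nonempty (X ≃ₘ⟮𝓡 4, 𝓡 4⟯ (Metric.sphere (0 : EuclideanSpace ℝ (Fin 5)) 1))) → (∀ (X : Type) [TopologicalSpace X] [T2Space X] [SecondCountableTopology X] [ChartedSpace (EuclideanSpace ℝ (Fin 4)) X] [IsManifold (𝓡 4) ∞ X] [CompactSpace X], Literature.Topology.FourManifolds.IsCappellShanesonSphereOf B X → Nonempty (X ≃ₘ⟮𝓡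 4, 𝓡 4⟯ (Metric.sphere (0 : EuclideanSpace ℝ (Fin 5)) 1)))

-- parent: CSStandard · child (gen 1)
/--     item stmt-SmoothPoincare4-32670 · crux · RESIDUAL (gen 0; summit-strength until shown otherwise, D-0170) · rank 204 · open
    parent: CSStandard · by planner
    why it might fail: the residual is almost all of CS: for trace ≥ 79 class numbers grow ≈ n² and the one-step descent fraction decays (0.87 → 0.29 by trace 400, T-CS79), so infinitely many ⟨ᵀ,*⟩-orbits need a recognition argument that does not yet exist; an exotic Cappell–Shaneson sphere would sit here.
    sources: KimYamada2023, arXiv:1707.03860, Iwaki2025, arXiv:2404.05096, GompfAGT2010, arXiv:0908.1914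
[crux] TailOrbitStandard (ASYMPTOTIC REGIME = DECLARED RESIDUAL of the split, child 4 of the glued
split of CSStandard stmt-SmoothPoincare4-31396; species R — inside the Cappell–Shaneson stratum, no
existence fact consumed): for every Cappell–Shaneson matrix A (det(A−1) = ±1) OUTSIDE the window up
to inversion (det-1 trace ≥ 79 or ≤ −74, equivalently by KY duality n ↔ 5−n: det-1 traces ≥ 79 up to
the dual), S⁴-recognition holds for A, or for Aᵀ, or (det(A−1) = 1) for A*. S-implied; strictly
weaker than CSStandard. DIAL-HONEST: no theorem in print decides a positive-density set of large
traces; class numbers h(ℤ[Θₙ]) ≈ n² while Gompf's one-step descent (KimYamada Lemma 6.1 / Iwaki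
Lemma 5.2) catches a FRACTION 0.87 (traces 70–100), 0.70 (101–150), 0.56 (151–200), 0.42 (201–300),
0.29 (301–400) of classes (census T-CS79 j339616) — the bulk is predicted Gompf-isolated, which is
exactly where the two closures (one decision per ⟨ᵀ,*⟩-orbit of up to four Gompf classes) and NEW
topology (torus-bundle T-duality; Kirby calculus of Σ(A) vs Σ(Aᵀ), Σ(A*)) must bite. The window/tail
cut at Iwaki's table edge is movable (kernel pattern `tail_anti` of g9): any certified trace
migrates from Tail t -/
@[route_item "route-SmoothPoincare4-RootDecompAD"]
def TailOrbitStandard : Prop :=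
  open scoped ContDiff Manifold in ∀ A : Matrix.SpecialLinearGroup (Fin 3) ℤ, (((A : Matrix (Fin 3) (Fin 3) ℤ) - 1).det = 1 ∨ ((A : Matrix (Fin 3) (Fin 3) ℤ) - 1).det = -1) → ¬ ((((A : Matrix (Fin 3) (Fin 3) ℤ) - 1).det = 1 ∧ Matrix.trace (A : Matrix (Fin 3) (Fin 3) ℤ) ∈ Set.Icc (-73 : ℤ) 78) ∨ (((A : Matrix (Fin 3) (Fin 3) ℤ) - 1).det = -1 ∧ Matrix.trace (A : Matrix (Fin 3) (Fin 3) ℤ) ∈ Set.Icc (-74 : ℤ) 77)) → (∀ (X : Type) [TopologicalSpace X] [T2Space X] [SecondCountableTopology X] [ChartedSpace (EuclideanSpace ℝ (Fin 4)) X] [IsManifold (𝓡 4) ∞ X] [CompactSpace X], Literature.Topology.FourManifolds.IsCappellShanesonSphereOf A X → Nonempty (X ≃ₘ⟮𝓡 4, 𝓡 4⟯ (Metric.sphere (0 : EuclideanSpace ℝ (Fin 5)) 1))) ∨ (∀ (X : Type) [TopologicalSpace X] [T2Space X] [SecondCountableTopology X] [ChartedSpace (EuclideanSpace ℝ (Fin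 4)) X] [IsManifold (𝓡 4) ∞ X] [CompactSpace X], Literature.Topology.FourManifolds.IsCappellShanesonSphereOf (Matrix.SpecialLinearGroup.transpose A) X → Nonempty (X ≃ₘ⟮𝓡 4, 𝓡 4⟯ (Metric.sphere (0 : EuclideanSpace ℝ (Fin 5)) 1))) ∨ (((A : Matrix (Fin 3) (Fin 3) ℤ) - 1).det = 1 ∧ ∃ B : Matrix.SpecialLinearGroup (Fin 3) ℤ, (B : Matrix (Fin 3) (Fin 3) ℤ) = (A : Matrix (Fin 3) (Fin 3) ℤ) * (A : Matrix (Fin 3) (Fin 3) ℤ) + (1 - Matrix.trace (A : Matrix (Fin 3) (Fin 3) ℤ)) • (A : Matrix (Fin 3) (Fin 3) ℤ) + 1 ∧ ∀ (X : Type) [TopologicalSpace X] [T2Space X] [SecondCountableTopology X] [ChartedSpace (EuclideanSpace ℝ (Fin 4)) X] [IsManifold (𝓡 4) ∞ X] [CompactSpace X], Literature.Topology.FourManifolds.IsCappellShanesonSphereOf B X → Nonempty (X ≃ₘ⟮𝓡 4, 𝓡 4⟯ (Metric.sphere (0 : EuclideanSpace ℝ (Fin 5)) 1)))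

-- parent: CSStandard · glue (gen 1)
/--     item stmt-SmoothPoincare4-32671 · support · rank 205 · closed · proved by Summit.SmoothPoincare4.SmoothPoincare4.Theorems.RootDecompADCSStandardSplit.csStandardGlue_holds (prover)
    parent: CSStandard · GLUE: children ⟹ parent · by planner
TransposeClosure → DualClosure → WindowOrbitStandard → TailOrbitStandard → CSStandard -/
@[route_item "route-SmoothPoincare4-RootDecompAD"]
def CSStandardGlue : Prop :=
  TransposeClosure → WindowOrbitStandard → DualClosure → TailOrbitStandard → CSStandard

-- `CSStandardGlue` holds: proved by `Summit.SmoothPoincare4.SmoothPoincare4.Theorems.RootDecompADCSStandardSplit.csStandardGlue_holds` (its module imports this route file, so no `_holds` link can be stated here).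

/-- item stmt-SmoothPoincare4-31397 · crux · RESIDUAL (gen 0; summit-strength until shown otherwise, D-0170) · leaf IDEA-NEEDED · rank 3 · open · by planner
why it might fail: an exotic homotopy 4-sphere outside the Cappell–Shaneson construction (e.g. a Gluck twist of a non-fibred 2-knot, or a cork twist of S⁴ if any is exotic) — NonCS is SPC4 on the complement of one countable named family.
sources: Kirby1997, FreedmanGompfMorrisonWalker2010, GompfAGT2010, KimYamada2023
[crux] NonCS (NEW, DECLARED RESIDUAL): for every smooth homotopy 4-sphere M (Statement binders, e :
M ≃ₕ S⁴), IF M is not a Cappell–Shaneson sphere of any matrix (¬ `IsCappellShanesonSphere M`), THEN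
M ≅ S⁴. Exotic-only scope (S⁴ = Σ(A₀) is itself a Cappell–Shaneson sphere, Akbulut–Kirby 1979/1985 +
Gompf 1991, so modulo that theorem and `IsCappellShanesonSphereOf.of_diffeomorph` the hypothesis
excludes every standard sphere); kernel `nonCS_iff_summit_of_cs`: NonCS ⟺ S given CS. [critic
decomp-sp4-crit-1 g3 CLEARED HOME/STATUS.md line 742 2026-08-30T08:43:49Z (ledger row 89; birth
letter AD under the CLEARED-order policy, writer decision): NonCS NEW crux r3 · DECLARED RESIDUAL ·
COSTUME-GIVEN-CS by the lens kernel theorem (NonCS ⟺ S mod CS) · exotic-only scope · IDEA-NEEDED (no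
instrument; may contain every exotic sphere) — honest] [difficulty: open-problem] -/
@[route_item "route-SmoothPoincare4-RootDecompAD"]
def NonCSStandard : Prop :=
  open scoped ContDiff Manifold in ∀ (M : Type) [TopologicalSpace M] [T2Space M] [SecondCountableTopology M] [ChartedSpace (EuclideanSpace ℝ (Fin 4)) M] [IsManifold (𝓡 4) ∞ M], ContinuousMap.HomotopyEquiv M (Metric.sphere (0 : EuclideanSpace ℝ (Fin 5)) 1) → ¬ Literature.Topology.FourManifolds.IsCappellShanesonSphere M → Nonempty (M ≃ₘ⟮𝓡 4, 𝓡 4⟯ (Metric.sphere (0 : EuclideanSpace ℝ (Fin 5)) 1))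

/-- item stmt-SmoothPoincare4-31398 · assembly · rank 1 · open · by planner
why it might fail: it does not (kernel-proved `CSTraceLadder.closes`, a case split plus compactness of homotopy 4-spheres).
sources: KimYamada2023
[assembly] the flattened deciding chain CS → NonCS → SmoothPoincare4 (kept for the schema; the
deciding theorem is `closes` in route/glue.lean; file `aside` if BC6 requires). [deps: CSStandard,
NonCSStandard] [difficulty: provable-now] -/
@[route_item "route-SmoothPoincare4-RootDecompAD"]
def Assembly : Prop :=
  Summit.SmoothPoincare4.SmoothPoincare4.Theses.RootDecompAD.CSStandard → Summit.SmoothPoincare4.SmoothPoincare4.Theses.RootDecompAD.NonCSStandard → _root_.SmoothPoincare4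

/-! D-0027 §2.1 — DECIDING THEOREM (planner-authored via `route open/edit --closes-file`; by planner-decomp-sp4-writer-1-g3-0 2026-08-30T08:49:41Z):
its hypotheses are this route's items and its conclusion the sub-problem Statement (glue_lint), and it elaborates with this file. -/

-- Deciding theorem of the gen-9 OR-sibling root route «CSTraceLadder» (lens-5 g9) over its TWO items:
-- CSStandard (POOLED #0391, body = Literature.Topology.FourManifolds.CappellShanesonSpheresStandard) and NonCSStandard (NEW crux, declared residual).
-- Text = lens certificate `CSTraceLadder.closes` (g9/CSTraceLadder.lean, rc 0, axioms {propext, Classical.choice, Quot.sound}); case split + compactness of homotopy 4-spheres.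
@[closes "route-SmoothPoincare4-RootDecompAD"] theorem closes (hCS : CSStandard) (hN : NonCSStandard) : _root_.SmoothPoincare4 := by
  intro M _ _ _ _ _ e
  by_cases hM : Literature.Topology.FourManifolds.IsCappellShanesonSphere M
  · haveI : CompactSpace M := Literature.Topology.FourManifolds.compactSpace_of_homotopyEquiv_sphere_four_holds M e
    exact hCS M hM
  · exact hN M e hM

end Summit.SmoothPoincare4.SmoothPoincare4.Theses.RootDecompAD
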